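import Summits.QuantumFields.YangMills.Theorems.AllWindowsColdBoxBoxHighLineWickTwoPairs

/-!
# Two Wick-ordered squares against a PAIR OF THREE-LEG VERTICES: the connected part is `O(m_ab·M²·αβ + M·(αβ)²)` (side bookkeeping)

LEAD seat `ym-line-sfw-p2` (g78), cell ym-idea-1; U5 prep, helper-grade (`U5-BLOCKERS.md` §2 lift L3: the connected four-point term of
`f″(0) = κ₄,₀`).  Continuation of ✓`…WickTwoPairs` (`integral_wick2_wick2_mul_prod_connected`).

For a centred Gaussian process `X` and legs `y : κ → T` with two-point function `S(i,i') = E[X_{y i}X_{y i'}]`: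

* §1 `abs_integral_prod_le_of_cov_le` — the CRUDE Wick bound `|E[∏_{j∈t} X_{y j}]| ≤ |t|!·M^{⌊|t|/2⌋}` when `|S(i,i')| ≤ M` on `t` (first-leg
  recursion + induction; `(2k−1)!! ≤ (2k)!`);
* §2 `integral_prod_eq_zero_of_signed_sum_ne_zero` — SIDE PARITY: if every leg carries a sign `χ i = ±1`, legs of equal sign are uncorrelated
  (`S(i,i') = 0`), and `Σ_{i∈t} χ i ≠ 0`, then `E[∏_{j∈t} X_{y j}] = 0` (every Wick pairing must join opposite signs);
* §3 ★★ `abs_connected_wick22_twoVertex_le` — for two three-leg vertices `u, w : Fin 3 → T` whose legs are uncorrelated INSIDE each vertex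
  (the ε/colour structure of ✓T-S5.7a's `tripleForm`), cross-correlated by at most `M`, and two Wick squares `:X_a²:`, `:X_b²:` with
  `|S(a,b)| ≤ m_ab`, `|S(a,u·)| ≤ αx`, `|S(a,w·)| ≤ αy`, `|S(b,u·)| ≤ βx`, `|S(b,w·)| ≤ βy`:
  `|E[:X_a²::X_b²:∏_{u,w}X] − E[:X_a²::X_b²:]·E[∏_{u,w}X]| ≤ 864·m_ab·M²·(αx·βy + αy·βx) + 324·M·(αx·βy + αy·βx)²`
  — the one-line diagrams (a–b line, `a → vertex`, `b → other vertex`, double line between the vertices) and the no-line diagrams (two legs of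
  `{a,a,b,b}` into each vertex, one line between the vertices); same-side attachments are killed by §2.

In the U5 chain this is the per-`(p,p′)` estimate of `E₀[L̃₀L̃_T·P_pP_{p′}] − E₀[L̃₀L̃_T]E₀[P_pP_{p′}]` (`P_p = tripleForm` vertex at the plaquette `p`,
`L = |ℓ|²` the Gaussian part of the plaquette cost): with ✓S3b `αx ~ (1+d(0,x))⁻²/β`, `M ~ (1+d(x,y))⁻²/β` the sum over `p, p′` is
`≲ (1+log H)^m/β³` by ✓`cubeTwoCentreSums` (this seat's next file).

Mathlib + ✓`WickTwoPairs` + ✓`GaussianWickTheorem`; no definitions; standard axioms.  HONEST LABEL: a probabilistic tool for the RECORDED lift L3 of the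
NEXT rung U5 (⟨stmt-QuantumFields-24336⟩, UNSTAFFED); ⟨24004⟩ ⟨24336⟩ and this seat's crux ⟨stmt-QuantumFields-22884⟩ remain OPEN; route AllWindowsColdBox
is DRAFT; no crux, rung or summit is proved; **the Yang–Mills mass gap is NOT proved by this file; no summit is proved by a line.**
-/

set_option autoImplicit false

noncomputable section

open MeasureTheory ProbabilityTheory Finset
open scoped Nat
open Literature.Probability.Distributions.GaussianWick

namespace Summit.QuantumFields.YangMills.Theorems.AllWindowsColdBoxBoxHighLine

namespace WickTwoPairs

variable {T Ω : Type*} {mΩ : MeasurableSpace Ω} {P : Measure Ω} {X : T → Ω → ℝ}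

/-! ## §1 The crude Wick bound on a product of legs -/

/-- ★ **Crude Wick bound**: if `|E[X_{y i}X_{y i'}]| ≤ M` for all distinct `i, i' ∈ t` (`M ≥ 0`) then `|E[∏_{j∈t} X_{y j}]| ≤ |t|!·M^{⌊|t|/2⌋}`
(induction on `|t|` along the first-leg recursion ✓`integral_mul_prod_eq_sum`; a centred Gaussian process on a probability space). -/
theorem abs_integral_prod_le_of_cov_le (hX : IsGaussianProcess X P) (h0 : ∀ t, ∫ ω, X t ω ∂P = 0)
    {κ : Type*} [DecidableEq κ] (y : κ → T) {M : ℝ} (hM : 0 ≤ M) (t : Finset κ)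
    (hS : ∀ i ∈ t, ∀ i' ∈ t, i ≠ i' → |∫ ω, X (y i) ω * X (y i') ω ∂P| ≤ M) :
    |∫ ω, ∏ j ∈ t, X (y j) ω ∂P| ≤ (t.card ! : ℝ) * M ^ (t.card / 2) := by
  have hPm := hX.isProbabilityMeasure
  -- strong induction on the cardinality
  suffices h : ∀ n : ℕ, ∀ t : Finset κ, t.card = n →
      (∀ i ∈ t, ∀ i' ∈ t, i ≠ i' → |∫ ω, X (y i) ω * X (y i') ω ∂P| ≤ M) →
      |∫ ω, ∏ j ∈ t, X (y j) ω ∂P| ≤ (n ! : ℝ) * M ^ (n / 2) from h t.card t rfl hS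
  intro n
  induction n using Nat.strong_induction_on with
  | _ n ih =>
    intro t ht hSt
    rcases t.eq_empty_or_nonempty with rfl | ⟨i₀, hi₀⟩
    · simp only [Finset.card_empty] at ht
      subst ht
      simp
    · have hn1 : 1 ≤ n := by rw [← ht]; exact Finset.card_pos.mpr ⟨i₀, hi₀⟩
      have hrec := integral_mul_prod_eq_sum hX h0 (y i₀) (t.erase i₀) y
      have hsplit : ∫ ω, ∏ j ∈ t, X (y j) ω ∂P = ∫ ω, X (y i₀) ω * ∏ j ∈ t.erase i₀, X (y j) ω ∂P := by
        refine integral_congr_ae (ae_of_all _ fun ω => ?_)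
        exact (Finset.mul_prod_erase t (fun j => X (y j) ω) hi₀).symm
      rw [hsplit, hrec]
      -- each term: `|S(i₀,i)| ≤ M` and the induction hypothesis at `n − 2`
      have hcard : ∀ i ∈ t.erase i₀, ((t.erase i₀).erase i).card = n - 2 := by
        intro i hi
        rw [Finset.card_erase_of_mem hi, Finset.card_erase_of_mem hi₀, ht]
        omega
      have hterm : ∀ i ∈ t.erase i₀, |(∫ ω, X (y i₀) ω * X (y i) ω ∂P) * ∫ ω, ∏ j ∈ (t.erase i₀).erase i, X (y j) ω ∂P| ≤
          M * (((n - 2) ! : ℝ) * M ^ ((n - 2) / 2)) := by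
        intro i hi
        have hi' : i ∈ t := Finset.mem_of_mem_erase hi
        have hne : i₀ ≠ i := fun h => (Finset.ne_of_mem_erase hi) h.symm
        rw [abs_mul]
        refine mul_le_mul (hSt i₀ hi₀ i hi' hne) ?_ (abs_nonneg _) hM
        have hlt : n - 2 < n := by omega
        refine ih (n - 2) hlt ((t.erase i₀).erase i) (hcard i hi) fun j hj j' hj' hjj' => ?_
        exact hSt j (Finset.mem_of_mem_erase (Finset.mem_of_mem_erase hj))
          j' (Finset.mem_of_mem_erase (Finset.mem_of_mem_erase hj')) hjj'
      calc |∑ i ∈ t.erase i₀, (∫ ω, X (y i₀) ω * X (y i) ω ∂P) * ∫ ω, ∏ j ∈ (t.erase i₀).erase i, X (y j) ω ∂P|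
          ≤ ∑ i ∈ t.erase i₀, |(∫ ω, X (y i₀) ω * X (y i) ω ∂P) * ∫ ω, ∏ j ∈ (t.erase i₀).erase i, X (y j) ω ∂P| :=
            Finset.abs_sum_le_sum_abs _ _
        _ ≤ ∑ _i ∈ t.erase i₀, M * (((n - 2) ! : ℝ) * M ^ ((n - 2) / 2)) := Finset.sum_le_sum hterm
        _ = ((n - 1 : ℕ) : ℝ) * (M * (((n - 2) ! : ℝ) * M ^ ((n - 2) / 2))) := by
            rw [Finset.sum_const, Finset.card_erase_of_mem hi₀, ht, nsmul_eq_mul]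
        _ ≤ (n ! : ℝ) * M ^ (n / 2) := by
            rcases Nat.lt_or_ge n 2 with hlt | hge
            · -- `n = 1`: the sum is empty (factor `n − 1 = 0`)
              have h1 : n = 1 := by omega
              subst h1
              simp
            · have hfac : ((n - 1 : ℕ) : ℝ) * ((n - 2) ! : ℝ) ≤ (n ! : ℝ) := by
                have h1 : (n - 1) * (n - 2)! = (n - 1)! := by
                  have := Nat.factorial_succ (n - 2)
                  rw [show n - 2 + 1 = n - 1 by omega] at this
                  rw [this]
                have h2 : (n - 1)! ≤ n ! := Nat.factorial_le (by omega)
                exact_mod_cast (h1 ▸ h2 : (n - 1) * (n - 2)! ≤ n !)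
              have hpow : M * M ^ ((n - 2) / 2) = M ^ (n / 2) := by
                rw [← pow_succ', show (n - 2) / 2 + 1 = n / 2 by omega]
              calc ((n - 1 : ℕ) : ℝ) * (M * (((n - 2) ! : ℝ) * M ^ ((n - 2) / 2)))
                  = (((n - 1 : ℕ) : ℝ) * ((n - 2) ! : ℝ)) * (M * M ^ ((n - 2) / 2)) := by ring
                _ ≤ (n ! : ℝ) * (M * M ^ ((n - 2) / 2)) :=
                    mul_le_mul_of_nonneg_right hfac (mul_nonneg hM (pow_nonneg hM _))
                _ = (n ! : ℝ) * M ^ (n / 2) := by rw [hpow]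

/-! ## §2 Side parity: a product with a sign imbalance integrates to zero -/

/-- ★ **Side parity.**  Legs carry signs `χ i ∈ {1, −1}`; legs of EQUAL sign are uncorrelated on `t`.  If `Σ_{i∈t} χ i ≠ 0` then
`E[∏_{j∈t} X_{y j}] = 0`: in the first-leg recursion only opposite-sign contractions survive, and they preserve the imbalance. -/
theorem integral_prod_eq_zero_of_signed_sum_ne_zero (hX : IsGaussianProcess X P) (h0 : ∀ t, ∫ ω, X t ω ∂P = 0)
    {κ : Type*} [DecidableEq κ] (y : κ → T) (χ : κ → ℤ) (hχ : ∀ i, χ i = 1 ∨ χ i = -1) (t : Finset κ)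
    (hS : ∀ i ∈ t, ∀ i' ∈ t, i ≠ i' → χ i = χ i' → ∫ ω, X (y i) ω * X (y i') ω ∂P = 0)
    (hsum : ∑ i ∈ t, χ i ≠ 0) :
    ∫ ω, ∏ j ∈ t, X (y j) ω ∂P = 0 := by
  suffices h : ∀ n : ℕ, ∀ t : Finset κ, t.card = n →
      (∀ i ∈ t, ∀ i' ∈ t, i ≠ i' → χ i = χ i' → ∫ ω, X (y i) ω * X (y i') ω ∂P = 0) →
      ∑ i ∈ t, χ i ≠ 0 → ∫ ω, ∏ j ∈ t, X (y j) ω ∂P = 0 from h t.card t rfl hS hsum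
  intro n
  induction n using Nat.strong_induction_on with
  | _ n ih =>
    intro t ht hSt hsumt
    rcases t.eq_empty_or_nonempty with rfl | ⟨i₀, hi₀⟩
    · simp at hsumt
    · have hrec := integral_mul_prod_eq_sum hX h0 (y i₀) (t.erase i₀) y
      have hsplit : ∫ ω, ∏ j ∈ t, X (y j) ω ∂P = ∫ ω, X (y i₀) ω * ∏ j ∈ t.erase i₀, X (y j) ω ∂P := by
        refine integral_congr_ae (ae_of_all _ fun ω => ?_)
        exact (Finset.mul_prod_erase t (fun j => X (y j) ω) hi₀).symm
      rw [hsplit, hrec]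
      refine Finset.sum_eq_zero fun i hi => ?_
      have hi' : i ∈ t := Finset.mem_of_mem_erase hi
      have hne : i₀ ≠ i := fun h => (Finset.ne_of_mem_erase hi) h.symm
      by_cases hc : χ i₀ = χ i
      · rw [hSt i₀ hi₀ i hi' hne hc, zero_mul]
      · -- opposite signs: the remaining legs keep the imbalance
        have hopp : χ i₀ + χ i = 0 := by
          rcases hχ i₀ with h1 | h1 <;> rcases hχ i with h2 | h2 <;> simp_all
        have hcard : ((t.erase i₀).erase i).card = n - 2 := by
          rw [Finset.card_erase_of_mem hi, Finset.card_erase_of_mem hi₀, ht]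
          omega
        have hlt : n - 2 < n := by
          have : 1 ≤ n := by rw [← ht]; exact Finset.card_pos.mpr ⟨i₀, hi₀⟩
          omega
        have hsum' : ∑ j ∈ (t.erase i₀).erase i, χ j ≠ 0 := by
          rw [Finset.sum_erase_eq_sub hi, Finset.sum_erase_eq_sub hi₀]
          intro h; apply hsumt; linarith
        rw [ih (n - 2) hlt _ hcard (fun j hj j' hj' hjj' hcj => hSt j
          (Finset.mem_of_mem_erase (Finset.mem_of_mem_erase hj)) j'
          (Finset.mem_of_mem_erase (Finset.mem_of_mem_erase hj')) hjj' hcj) hsum', mul_zero]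

/-! ## §3 Two Wick squares against a pair of three-leg vertices -/

/-- ★★ **CONNECTED PART OF TWO WICK SQUARES AGAINST TWO THREE-LEG VERTICES.**  Let `u, w : Fin 3 → T` be the legs of two vertices, uncorrelated
inside each vertex and cross-correlated by at most `M ≥ 0`; let `a, b : T` with `|E[X_aX_b]| ≤ m_ab`, `|E[X_aX_{u i}]| ≤ αx`, `|E[X_aX_{w i}]| ≤ αy`,
`|E[X_bX_{u i}]| ≤ βx`, `|E[X_bX_{w i}]| ≤ βy`.  Then, with `:X_a²: = X_a² − E[X_a²]` and `∏ = ∏_i X_{u i} · ∏_i X_{w i}`,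
`|E[:X_a²::X_b²:∏] − E[:X_a²::X_b²:]·E[∏]| ≤ 864·m_ab·M²·(αx·βy + αy·βx) + 324·M·(αx·βy + αy·βx)²`. -/
theorem abs_connected_wick22_twoVertex_le (hX : IsGaussianProcess X P) (h0 : ∀ t, ∫ ω, X t ω ∂P = 0)
    (u w : Fin 3 → T) (a b : T) {M mab αx αy βx βy : ℝ} (hM : 0 ≤ M)
    (hu : ∀ i i', i ≠ i' → ∫ ω, X (u i) ω * X (u i') ω ∂P = 0)
    (hw : ∀ i i', i ≠ i' → ∫ ω, X (w i) ω * X (w i') ω ∂P = 0)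
    (hcross : ∀ i j, |∫ ω, X (u i) ω * X (w j) ω ∂P| ≤ M)
    (hab : |∫ ω, X a ω * X b ω ∂P| ≤ mab)
    (hax : ∀ i, |∫ ω, X a ω * X (u i) ω ∂P| ≤ αx) (hay : ∀ i, |∫ ω, X a ω * X (w i) ω ∂P| ≤ αy)
    (hbx : ∀ i, |∫ ω, X b ω * X (u i) ω ∂P| ≤ βx) (hby : ∀ i, |∫ ω, X b ω * X (w i) ω ∂P| ≤ βy) :
    |∫ ω, (X a ω * X a ω - ∫ ω', X a ω' * X a ω' ∂P) * (X b ω * X b ω - ∫ ω', X b ω' * X b ω' ∂P) *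
          ∏ j : Fin 3 ⊕ Fin 3, X (Sum.elim u w j) ω ∂P
        - (∫ ω, (X a ω * X a ω - ∫ ω', X a ω' * X a ω' ∂P) * (X b ω * X b ω - ∫ ω', X b ω' * X b ω' ∂P) ∂P) *
          ∫ ω, ∏ j : Fin 3 ⊕ Fin 3, X (Sum.elim u w j) ω ∂P| ≤
      864 * mab * M ^ 2 * (αx * βy + αy * βx) + 324 * M * (αx * βy + αy * βx) ^ 2 := by
  classical
  have hPm := hX.isProbabilityMeasure
  set y : Fin 3 ⊕ Fin 3 → T := Sum.elim u w with hy
  set S : T → T → ℝ := fun s t => ∫ ω, X s ω * X t ω ∂P with hSdef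
  -- signs and side-dependent bounds
  set χ : Fin 3 ⊕ Fin 3 → ℤ := Sum.elim (fun _ => 1) (fun _ => -1) with hχ
  set αf : Fin 3 ⊕ Fin 3 → ℝ := Sum.elim (fun _ => αx) (fun _ => αy) with hαf
  set βf : Fin 3 ⊕ Fin 3 → ℝ := Sum.elim (fun _ => βx) (fun _ => βy) with hβf
  have hχ1 : ∀ i, χ i = 1 ∨ χ i = -1 := fun i => by cases i <;> simp [hχ]
  have hχsum : ∑ i : Fin 3 ⊕ Fin 3, χ i = 0 := by simp [hχ, Fintype.sum_sum_type]
  have hSa : ∀ j, |S a (y j)| ≤ αf j := fun j => by cases j <;> simp [hy, hαf, hSdef, hax, hay]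
  have hSb : ∀ j, |S b (y j)| ≤ βf j := fun j => by cases j <;> simp [hy, hβf, hSdef, hbx, hby]
  have hαf0 : ∀ j, 0 ≤ αf j := fun j => (abs_nonneg _).trans (hSa j)
  have hβf0 : ∀ j, 0 ≤ βf j := fun j => (abs_nonneg _).trans (hSb j)
  have hmab0 : 0 ≤ mab := (abs_nonneg _).trans hab
  have hαx0 : 0 ≤ αx := (abs_nonneg _).trans (hax 0)
  have hαy0 : 0 ≤ αy := (abs_nonneg _).trans (hay 0)
  have hβx0 : 0 ≤ βx := (abs_nonneg _).trans (hbx 0)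
  have hβy0 : 0 ≤ βy := (abs_nonneg _).trans (hby 0)
  -- the two-point function on the six legs: zero inside a vertex, `≤ M` across
  have hintra : ∀ i i' : Fin 3 ⊕ Fin 3, i ≠ i' → χ i = χ i' → S (y i) (y i') = 0 := by
    rintro (i | i) (i' | i') hne hc
    · exact hu i i' fun h => hne (by rw [h])
    · simp [hχ] at hc
    · simp [hχ] at hc
    · exact hw i i' fun h => hne (by rw [h])
  have hS2 : ∀ i i' : Fin 3 ⊕ Fin 3, i ≠ i' → |S (y i) (y i')| ≤ M := by
    rintro (i | i) (i' | i') hne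
    · rw [hintra _ _ hne (by simp [hχ]), abs_zero]; exact hM
    · exact hcross i i'
    · have hsymm : S (w i) (u i') = S (u i') (w i) := by
        simp only [hSdef]; exact integral_congr_ae (ae_of_all _ fun ω => by ring)
      show |S (w i) (u i')| ≤ M
      rw [hsymm]; exact hcross i' i
    · rw [hintra _ _ hne (by simp [hχ]), abs_zero]; exact hM
  -- the connected expansion (✓WickTwoPairs)
  have hconn := integral_wick2_wick2_mul_prod_connected hX h0 a a b b (Finset.univ : Finset (Fin 3 ⊕ Fin 3)) y
  rw [hconn]
  -- TERM 1: one `a–b` line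
  have hE4 : ∀ j k : Fin 3 ⊕ Fin 3, j ≠ k →
      |∫ ω, ∏ i ∈ (Finset.univ.erase j).erase k, X (y i) ω ∂P| ≤ if χ j = χ k then 0 else 24 * M ^ 2 := by
    intro j k hjk
    have hk : k ∈ Finset.univ.erase j := Finset.mem_erase.mpr ⟨hjk.symm, Finset.mem_univ k⟩
    split_ifs with hc
    · rw [integral_prod_eq_zero_of_signed_sum_ne_zero hX h0 y χ hχ1 _ (fun i _ i' _ hne hci => hintra i i' hne hci) ?_,
        abs_zero]
      rw [Finset.sum_erase_eq_sub hk, Finset.sum_erase_eq_sub (Finset.mem_univ j), hχsum, hc]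
      rcases hχ1 k with h | h <;> rw [h] <;> norm_num
    · have hcard : ((Finset.univ.erase j).erase k).card = 4 := by
        rw [Finset.card_erase_of_mem hk, Finset.card_erase_of_mem (Finset.mem_univ j), Finset.card_univ,
          Fintype.card_sum, Fintype.card_fin]
      have h := abs_integral_prod_le_of_cov_le hX h0 y hM ((Finset.univ.erase j).erase k)
        (fun i _ i' _ hne => hS2 i i' hne)
      rw [hcard] at h
      have h24 : ((4 : ℕ) ! : ℝ) = 24 := by norm_num [Nat.factorial]
      simpa [h24] using h
  have hT1 : |∑ j : Fin 3 ⊕ Fin 3, ∑ k ∈ Finset.univ.erase j,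
        (S a b * S a (y j) * S b (y k) + S a b * S a (y j) * S b (y k) + S a b * S a (y j) * S b (y k)
          + S a b * S a (y j) * S b (y k)) * ∫ ω, ∏ i ∈ (Finset.univ.erase j).erase k, X (y i) ω ∂P| ≤
      ∑ j : Fin 3 ⊕ Fin 3, ∑ k : Fin 3 ⊕ Fin 3, 4 * mab * αf j * βf k * (if χ j = χ k then 0 else 24 * M ^ 2) := by
    refine (Finset.abs_sum_le_sum_abs _ _).trans (Finset.sum_le_sum fun j _ => ?_)
    refine (Finset.abs_sum_le_sum_abs _ _).trans ?_
    refine (Finset.sum_le_sum fun k hk => ?_).trans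
      (Finset.sum_le_sum_of_subset_of_nonneg (Finset.erase_subset _ _) fun k _ _ => ?_)
    · have hjk : j ≠ k := fun h => (Finset.ne_of_mem_erase hk) h.symm
      rw [abs_mul]
      refine mul_le_mul ?_ (hE4 j k hjk) (abs_nonneg _)
        (mul_nonneg (mul_nonneg (mul_nonneg (by norm_num) hmab0) (hαf0 j)) (hβf0 k))
      have h3 : |S a b * S a (y j) * S b (y k)| ≤ mab * αf j * βf k := by
        rw [abs_mul, abs_mul]
        exact mul_le_mul (mul_le_mul hab (hSa j) (abs_nonneg _) hmab0) (hSb k) (abs_nonneg _)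
          (mul_nonneg hmab0 (hαf0 j))
      calc _ ≤ |S a b * S a (y j) * S b (y k)| + |S a b * S a (y j) * S b (y k)| + |S a b * S a (y j) * S b (y k)|
              + |S a b * S a (y j) * S b (y k)| := by
            refine (abs_add_le _ _).trans ?_
            gcongr
            refine (abs_add_le _ _).trans ?_
            gcongr
            exact abs_add_le _ _
        _ ≤ _ := by linarith
    · exact mul_nonneg (mul_nonneg (mul_nonneg (mul_nonneg (by norm_num) hmab0) (hαf0 _)) (hβf0 _))
        (by split_ifs <;> positivity)
  have hT1v : ∑ j : Fin 3 ⊕ Fin 3, ∑ k : Fin 3 ⊕ Fin 3, 4 * mab * αf j * βf k * (if χ j = χ k then 0 else 24 * M ^ 2) =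
      864 * mab * M ^ 2 * (αx * βy + αy * βx) := by
    simp only [Fintype.sum_sum_type, hχ, hαf, hβf, Sum.elim_inl, Sum.elim_inr]
    norm_num
    ring
  -- TERM 2: no `a–b` line
  have hE2 : ∀ j j' k k' : Fin 3 ⊕ Fin 3, j' ∈ Finset.univ.erase j → k ∈ (Finset.univ.erase j).erase j' →
      k' ∈ ((Finset.univ.erase j).erase j').erase k →
      |∫ ω, ∏ i ∈ (((Finset.univ.erase j).erase j').erase k).erase k', X (y i) ω ∂P| ≤
        if χ j + χ j' + χ k + χ k' = 0 then 2 * M else 0 := by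
    intro j j' k k' hj' hk hk'
    split_ifs with hc
    · have hcard : ((((Finset.univ.erase j).erase j').erase k).erase k').card = 2 := by
        rw [Finset.card_erase_of_mem hk', Finset.card_erase_of_mem hk, Finset.card_erase_of_mem hj',
          Finset.card_erase_of_mem (Finset.mem_univ j), Finset.card_univ, Fintype.card_sum, Fintype.card_fin]
      have h := abs_integral_prod_le_of_cov_le hX h0 y hM ((((Finset.univ.erase j).erase j').erase k).erase k')
        (fun i _ i' _ hne => hS2 i i' hne)
      rw [hcard] at h
      simpa using h
    · rw [integral_prod_eq_zero_of_signed_sum_ne_zero hX h0 y χ hχ1 _ (fun i _ i' _ hne hci => hintra i i' hne hci) ?_,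
        abs_zero]
      rw [Finset.sum_erase_eq_sub hk', Finset.sum_erase_eq_sub hk, Finset.sum_erase_eq_sub hj',
        Finset.sum_erase_eq_sub (Finset.mem_univ j), hχsum]
      intro h; apply hc; linarith
  have hT2 : |∑ j : Fin 3 ⊕ Fin 3, ∑ j' ∈ Finset.univ.erase j, ∑ k ∈ (Finset.univ.erase j).erase j',
        ∑ k' ∈ ((Finset.univ.erase j).erase j').erase k,
          S a (y j) * S a (y j') * S b (y k) * S b (y k') *
            ∫ ω, ∏ i ∈ (((Finset.univ.erase j).erase j').erase k).erase k', X (y i) ω ∂P| ≤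
      ∑ j : Fin 3 ⊕ Fin 3, ∑ j' : Fin 3 ⊕ Fin 3, ∑ k : Fin 3 ⊕ Fin 3, ∑ k' : Fin 3 ⊕ Fin 3,
        αf j * αf j' * βf k * βf k' * (if χ j + χ j' + χ k + χ k' = 0 then 2 * M else 0) := by
    have hg0 : ∀ j j' k k' : Fin 3 ⊕ Fin 3,
        0 ≤ αf j * αf j' * βf k * βf k' * (if χ j + χ j' + χ k + χ k' = 0 then 2 * M else 0) := fun j j' k k' =>
      mul_nonneg (mul_nonneg (mul_nonneg (mul_nonneg (hαf0 _) (hαf0 _)) (hβf0 _)) (hβf0 _)) (by split_ifs <;> positivity)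
    refine (Finset.abs_sum_le_sum_abs _ _).trans (Finset.sum_le_sum fun j _ => ?_)
    refine (Finset.abs_sum_le_sum_abs _ _).trans ?_
    refine (Finset.sum_le_sum fun j' hj' => ?_).trans
      (Finset.sum_le_sum_of_subset_of_nonneg (Finset.erase_subset _ _) fun j' _ _ =>
        Finset.sum_nonneg fun k _ => Finset.sum_nonneg fun k' _ => hg0 j j' k k')
    refine (Finset.abs_sum_le_sum_abs _ _).trans ?_
    refine (Finset.sum_le_sum fun k hk => ?_).trans
      (Finset.sum_le_sum_of_subset_of_nonneg ((Finset.erase_subset _ _).trans (Finset.erase_subset _ _))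
        fun k _ _ => Finset.sum_nonneg fun k' _ => hg0 j j' k k')
    refine (Finset.abs_sum_le_sum_abs _ _).trans ?_
    refine (Finset.sum_le_sum fun k' hk' => ?_).trans
      (Finset.sum_le_sum_of_subset_of_nonneg
        (((Finset.erase_subset _ _).trans (Finset.erase_subset _ _)).trans (Finset.erase_subset _ _))
        fun k' _ _ => hg0 j j' k k')
    rw [abs_mul]
    refine mul_le_mul ?_ (hE2 j j' k k' hj' hk hk') (abs_nonneg _)
      (mul_nonneg (mul_nonneg (mul_nonneg (hαf0 _) (hαf0 _)) (hβf0 _)) (hβf0 _))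
    rw [abs_mul, abs_mul, abs_mul]
    exact mul_le_mul (mul_le_mul (mul_le_mul (hSa j) (hSa j') (abs_nonneg _) (hαf0 _)) (hSb k) (abs_nonneg _)
      (mul_nonneg (hαf0 _) (hαf0 _))) (hSb k') (abs_nonneg _) (mul_nonneg (mul_nonneg (hαf0 _) (hαf0 _)) (hβf0 _))
  have hT2v : ∑ j : Fin 3 ⊕ Fin 3, ∑ j' : Fin 3 ⊕ Fin 3, ∑ k : Fin 3 ⊕ Fin 3, ∑ k' : Fin 3 ⊕ Fin 3,
        αf j * αf j' * βf k * βf k' * (if χ j + χ j' + χ k + χ k' = 0 then 2 * M else 0) =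
      162 * M * (αx ^ 2 * βy ^ 2 + αy ^ 2 * βx ^ 2 + 4 * (αx * αy * βx * βy)) := by
    simp only [Fintype.sum_sum_type, hχ, hαf, hβf, Sum.elim_inl, Sum.elim_inr]
    norm_num
    ring
  have hT2f : 162 * M * (αx ^ 2 * βy ^ 2 + αy ^ 2 * βx ^ 2 + 4 * (αx * αy * βx * βy)) ≤ 324 * M * (αx * βy + αy * βx) ^ 2 := by
    have hsq : αx ^ 2 * βy ^ 2 + αy ^ 2 * βx ^ 2 + 4 * (αx * αy * βx * βy) ≤ 2 * (αx * βy + αy * βx) ^ 2 := by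
      nlinarith [sq_nonneg (αx * βy), sq_nonneg (αy * βx)]
    nlinarith
  -- collect
  refine (abs_add_le _ _).trans ?_
  rw [← hT1v]
  exact add_le_add hT1 ((hT2.trans (le_of_eq hT2v)).trans hT2f)

end WickTwoPairs

end Summit.QuantumFields.YangMills.Theorems.AllWindowsColdBoxBoxHighLine

end
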